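import Summits.Ventures.WeilGRH.UniformConductorFloorLog8HalfTableValidA
import HarnessLib

/-!
# GRH arm (rh-explicit, venture WeilGRH): the special-value table at `a = (log 8)/2` — validity of the records of the modes `150 … 159`
  (kernel certificates, part G of seven)

Cell `rh-explicit`, WEIL TRACK — GRH ARM (weil-grh-1, gen9).  `checkTable` slice `[150, 160)` of `UniformConductorFloorLog8HalfTable.lean` (recompute
`Encl.idxRec` at every mode, test containment; ≈ 60 s), glued into `tab_valid` in `UniformConductorFloorLog8HalfTableValid.lean` (gen10 re-cut: parts import part A only and file in parallel) = the full `tab_valid : TabValid (2^80) a ks 160 tab`.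
No definitions; no named facts; standard axioms. [cite: Moore1966, Ch. 3 (interval arithmetic: inclusion property)]
-/

set_option maxRecDepth 200000

namespace Summit.Ventures.WeilGRH.Log8HalfTable
open Literature.NumberTheory.LFunctions Literature.NumberTheory.LFunctions.Yoshida1992 Encl Literature.Analysis.ValidatedNumerics.NumericsMP

/-- kernel: table slice `[150, 160)`. [cite: Moore1966, Ch. 3 (interval arithmetic: inclusion property)] -/
theorem tT150 : checkTable prm C tab 150 10 = true := by decide +kernel


end Summit.Ventures.WeilGRH.Log8HalfTable
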